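import Literature.NumberTheory.Automorphic.Zelevinsky1980.MaximalParabolicOpenCellRadical
import Literature.NumberTheory.Automorphic.ParabolicInduction
import Literature.NumberTheory.Automorphic.GLnIwahoriBorelFactorization
import Literature.NumberTheory.Automorphic.OpenCellCoinvariants
import HarnessLib

/-!
# The modulus of the maximal parabolic `Q_{N-1,1}(F)` at `d(ϖ) = diag(1, …, 1, ϖ)` and at `d₀(ϖ) = diag(ϖ, 1, …, 1)`

Topic `NumberTheory/Automorphic/Zelevinsky1980`; theorems only (no definition, no named fact). For a
non-archimedean local field `F` with residue field of cardinality `q_F`, a uniformizer `ϖ`, and the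
standard maximal parabolic `P = Q_{N-1,1} = standardParabolicGL F (lastBlockLabel N)` (`N = n + 2`),
Mathlib's modular character `Δ_P` (`MeasureTheory.Measure.modularCharacter` of `↥P`,
`map (· * g) μ = Δ(g) • μ`; this is the classical modulus `δ_P`, cf. `deltaChar_borel_gl_two_holds`)
takes the values

* `modularCharacter_diag_last_uniformizer` — `Δ_P(d(ϖ)) = q_F ^ (N - 1)` for `d(ϖ) = diag(1, …, 1, ϖ)`:
  `Δ(d) μ(K) = μ(d K d⁻¹)` for the compact open subgroup `K = P ∩ K_{v ϖ}`, and `d K d⁻¹ ⊇ K` is the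
  disjoint union of the `q_F^{N-1}` cosets `u(s ∘ κ) K`, `κ ∈ 𝓀_F^{N-1}`, of the last-column unipotents
  (`measure_iUnion_smul_subgroup`);
* `modularCharacter_diag_zero_uniformizer` — `Δ_P(d₀(ϖ)) = q_F⁻¹` for `d₀(ϖ) = diag(ϖ, 1, …, 1)`:
  `Δ_P` is a class function, the `d_i(ϖ)` (`i < N - 1`) are conjugate under the Weyl group of the
  Levi, their product with `d(ϖ)` is the central element `ϖ · 1` (modulus `1`), and `ℝ≥0` has unique
  `(N-1)`-th roots.

Hence `δ_P^{1/2}(d(ϖ)) = q_F^{(N-1)/2}` and `δ_P^{1/2}(d₀(ϖ)) = q_F^{-1/2}` (`rootDeltaChar`), the two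
exponents separating the closed and the open orbit of `Q_{N-1,1}` on `Q_{N-1,1} \ GL_N` in the
Jacquet module of `(ν₀ ∘ det) × χ′` (Bernstein–Zelevinsky 1977, 1.7 and §7.1; Zelevinsky 1980, §1.1,
§3.1: `δ^{1/2}` normalisation).

## References

* I. N. Bernstein, A. V. Zelevinsky, *Induced representations of reductive `p`-adic groups I*,
  Ann. Sci. ÉNS 10 (1977), 1.7 (the modulus as the module of inner automorphisms), §7.1.
  [BernsteinZelevinskyASENS1977]
* A. V. Zelevinsky, *Induced representations of reductive `p`-adic groups II*, Ann. Sci. ÉNS 13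
  (1980), §1.1, §3.1. [Zelevinsky1980]
-/

noncomputable section

open scoped NNReal ENNReal Pointwise
open Matrix MeasureTheory Literature.LinearAlgebra.Matrix.DiagonalTorus

namespace Literature.NumberTheory.Automorphic.Zelevinsky1980

open ValuativeRel Valued

variable {F : Type*} [Field F] {n : ℕ}

/-! ### The last-column unipotents `u(β) = 1 + ∑_{i < N-1} β_i E_{i,N-1}` -/

/-- Membership in `Q_{N-1,1}`: `g ∈ P` iff its last row is `(0, …, 0, *)`. [cite: Zelevinsky1980, §1.1] -/
theorem mem_standardParabolicGL_lastBlockLabel_iff (g : GL (Fin (n + 2)) F) :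
    g ∈ standardParabolicGL F (lastBlockLabel (n + 2)) ↔
      ∀ j : Fin (n + 2), j ≠ Fin.last (n + 1) → (g : Matrix (Fin (n + 2)) (Fin (n + 2)) F) (Fin.last (n + 1)) j = 0 := by
  rw [mem_standardParabolicGL_iff]
  have key : ∀ i j : Fin (n + 2), lastBlockLabel (n + 2) j < lastBlockLabel (n + 2) i ↔
      (j ≠ Fin.last (n + 1) ∧ i = Fin.last (n + 1)) := by
    intro i j
    have hl : ∀ k : Fin (n + 2), lastBlockLabel (n + 2) k = decide (k = Fin.last (n + 1)) := by
      intro k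
      simp only [lastBlockLabel, Fin.ext_iff, Fin.val_last]
      by_cases h : (k : ℕ) = n + 1
      · rw [decide_eq_true h, decide_eq_true (by omega)]
      · rw [decide_eq_false h, decide_eq_false (by have := k.2; omega)]
    rw [hl, hl]
    by_cases hi : i = Fin.last (n + 1) <;> by_cases hj : j = Fin.last (n + 1) <;> simp [hi, hj]
  constructor
  · intro h j hj
    exact h ((key _ _).2 ⟨hj, rfl⟩)
  · intro h i j hij
    obtain ⟨hj, hi⟩ := (key i j).1 hij
    rw [hi]
    exact h j hj

/-- **The last-column unipotents.** For `β : Fin (n+2) → F` there is `u ∈ Q_{N-1,1}` with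
`u = 1 + ∑_{i ≠ last} β_i E_{i,last}` and `u⁻¹ = 1 - ∑_{i ≠ last} β_i E_{i,last}` (these form the
unipotent radical `U_c ≅ F^{N-1}`). [cite: Zelevinsky1980, §1.1] -/
theorem exists_lastColumn_unipotent (β : Fin (n + 2) → F) :
    ∃ u : GL (Fin (n + 2)) F, u ∈ standardParabolicGL F (lastBlockLabel (n + 2)) ∧
      (∀ i j : Fin (n + 2), (u : Matrix (Fin (n + 2)) (Fin (n + 2)) F) i j =
        (1 : Matrix (Fin (n + 2)) (Fin (n + 2)) F) i j +
          if j = Fin.last (n + 1) ∧ i ≠ Fin.last (n + 1) then β i else 0) ∧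
      (∀ i j : Fin (n + 2), ((u⁻¹ : GL (Fin (n + 2)) F) : Matrix (Fin (n + 2)) (Fin (n + 2)) F) i j =
        (1 : Matrix (Fin (n + 2)) (Fin (n + 2)) F) i j -
          if j = Fin.last (n + 1) ∧ i ≠ Fin.last (n + 1) then β i else 0) := by
  set X : Matrix (Fin (n + 2)) (Fin (n + 2)) F :=
    Matrix.of fun i j => if j = Fin.last (n + 1) ∧ i ≠ Fin.last (n + 1) then β i else 0 with hX
  have hXX : X * X = 0 := by
    ext i k
    rw [Matrix.mul_apply, Matrix.zero_apply]
    refine Finset.sum_eq_zero fun j _ => ?_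
    simp only [hX, Matrix.of_apply]
    by_cases h1 : j = Fin.last (n + 1) ∧ i ≠ Fin.last (n + 1)
    · rw [if_neg (fun h2 : k = Fin.last (n + 1) ∧ j ≠ Fin.last (n + 1) => h2.2 h1.1), mul_zero]
    · rw [if_neg h1, zero_mul]
  let u : GL (Fin (n + 2)) F :=
    ⟨1 + X, 1 - X, by rw [add_mul, mul_sub, mul_sub, one_mul, mul_one, one_mul, hXX]; abel,
      by rw [sub_mul, mul_add, mul_add, one_mul, mul_one, one_mul, hXX]; abel⟩
  refine ⟨u, ?_, fun i j => ?_, fun i j => ?_⟩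
  · rw [mem_standardParabolicGL_lastBlockLabel_iff]
    intro j hj
    change (1 + X) (Fin.last (n + 1)) j = 0
    rw [Matrix.add_apply, Matrix.one_apply_ne (Ne.symm hj), hX, Matrix.of_apply, if_neg (fun h => h.2 rfl), add_zero]
  · change (1 + X) i j = _
    rw [Matrix.add_apply, hX, Matrix.of_apply]
  · change (1 - X) i j = _
    rw [Matrix.sub_apply, hX, Matrix.of_apply]

variable [ValuativeRel F] [TopologicalSpace F] [IsNonarchimedeanLocalField F]

omit [TopologicalSpace F] [IsNonarchimedeanLocalField F] in
/-- An element of `P` lies in `K_γ` (`γ < 1`) iff all entries of `g - 1` have valuation `≤ γ`.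
[cite: BernsteinZelevinskyASENS1977, 1.7] -/
theorem mem_congruenceGL_iff_valBound {γ : ValueGroupWithZero F} (hγ : γ < 1) (g : GL (Fin (n + 2)) F) :
    g ∈ congruenceGL (n + 2) γ ↔
      ∀ i j : Fin (n + 2), valuation F ((g : Matrix (Fin (n + 2)) (Fin (n + 2)) F) i j -
        (1 : Matrix (Fin (n + 2)) (Fin (n + 2)) F) i j) ≤ γ := by
  constructor
  · intro h i j
    have := valuation_apply_sub_one_le_of_mem_congruenceGL h i j
    rwa [Matrix.one_apply]
  · intro h
    exact mem_congruenceGL_of_valBound_sub_one hγ fun i j => by rw [Matrix.sub_apply]; exact h i j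

omit [TopologicalSpace F] [IsNonarchimedeanLocalField F] in
/-- For a uniformizer `ϖ`: `v y < 1 ↔ v y ≤ v ϖ`. [cite: BernsteinZelevinskyASENS1977, 1.7] -/
private theorem valuation_lt_one_iff_le_valuation' {ϖ : F} (hϖ : IsUniformizingElement ϖ) (y : F) :
    valuation F y < 1 ↔ valuation F y ≤ valuation F ϖ := by
  constructor
  · intro hy
    have hy' : y ∈ 𝒪[F] := (Valuation.mem_integer_iff _ _).2 hy.le
    obtain ⟨z, hz, rfl⟩ := hϖ.exists_eq_mul hy' hy
    rw [map_mul]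
    exact mul_le_of_le_one_right' ((Valuation.mem_integer_iff _ _).1 hz)
  · exact fun h => h.trans_lt hϖ.valuation_lt_one

/-! ### `Δ_P(d(ϖ)) = q_F ^ (N-1)` -/

/-- **The modulus of `Q_{N-1,1}` at `d(ϖ) = diag(1, …, 1, ϖ)` is `q_F^{N-1}`** (Mathlib's modular
character of `↥Q_{N-1,1}`; `N = n + 2`). Proof: for the compact open subgroup `K = Q_{N-1,1} ∩ K_{vϖ}`,
`Δ(d) μ(K) = μ(d K d⁻¹)` and `d K d⁻¹ = ⨆_{κ ∈ 𝓀_F^{N-1}} u(s ∘ κ) K` (disjoint cosets of the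
last-column unipotents, `s` a section of the residue map). (Bernstein–Zelevinsky 1977, 1.7: the
modulus is the module of the inner automorphism; classically `δ_{Q_{N-1,1}}(diag(a, t)) = |det a| |t|^{1-N}`.)
[cite: BernsteinZelevinskyASENS1977, 1.7] -/
theorem modularCharacter_diag_last_uniformizer {ϖ : F} (hϖ : IsUniformizingElement ϖ) :
    Measure.modularCharacter
        (⟨diagGL (Fin (n + 2)) (Function.update 1 (Fin.last (n + 1)) (Units.mk0 ϖ hϖ.ne_zero)),
          diagGL_mem_standardParabolicGL _ _⟩ : ↥(standardParabolicGL F (lastBlockLabel (n + 2)))) =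
      (GaloisRepresentations.IsNonarchimedeanLocalField.residueFieldCard F : ℝ≥0) ^ (n + 1) := by
  classical
  haveI : T2Space F := (GaloisRepresentations.IsNonarchimedeanLocalField.isLocalField F).toT2Space
  borelize ↥(standardParabolicGL F (lastBlockLabel (n + 2)))
  set μ : Measure ↥(standardParabolicGL F (lastBlockLabel (n + 2))) := Measure.haar with hμ
  set d : ↥(standardParabolicGL F (lastBlockLabel (n + 2))) :=
    ⟨diagGL (Fin (n + 2)) (Function.update 1 (Fin.last (n + 1)) (Units.mk0 ϖ hϖ.ne_zero)),
      diagGL_mem_standardParabolicGL _ _⟩ with hd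
  -- the compact open subgroup `K = P ∩ K_{v ϖ}`
  set γ : ValueGroupWithZero F := valuation F ϖ with hγ
  have hγ1 : γ < 1 := hϖ.valuation_lt_one
  have hγ0 : γ ≠ 0 := (Valuation.ne_zero_iff _).mpr hϖ.ne_zero
  set K : Subgroup ↥(standardParabolicGL F (lastBlockLabel (n + 2))) :=
    (congruenceGL (n + 2) γ).comap (standardParabolicGL F (lastBlockLabel (n + 2))).subtype with hK
  have hKo : IsOpen (K : Set ↥(standardParabolicGL F (lastBlockLabel (n + 2)))) :=
    (isOpen_congruenceGL hγ0).preimage continuous_subtype_val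
  have hKc : IsCompact (K : Set ↥(standardParabolicGL F (lastBlockLabel (n + 2)))) :=
    (isClosed_standardParabolicGL F (lastBlockLabel (n + 2))).isClosedEmbedding_subtypeVal.isCompact_preimage
      (isCompact_congruenceGL γ)
  have hKmem : ∀ y : ↥(standardParabolicGL F (lastBlockLabel (n + 2))), y ∈ K ↔
      ∀ i j : Fin (n + 2), valuation F (((y : GL (Fin (n + 2)) F) : Matrix (Fin (n + 2)) (Fin (n + 2)) F) i j -
        (1 : Matrix (Fin (n + 2)) (Fin (n + 2)) F) i j) ≤ γ := fun y => by
    rw [hK, Subgroup.mem_comap, Subgroup.coe_subtype]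
    exact mem_congruenceGL_iff_valBound hγ1 _
  -- the representatives `u(s ∘ κ)`
  obtain ⟨sec, hsec⟩ : ∃ sec : 𝓀[F] → 𝒪[F], ∀ κ, IsLocalRing.residue _ (sec κ) = κ :=
    ⟨Function.surjInv IsLocalRing.residue_surjective, Function.surjInv_eq IsLocalRing.residue_surjective⟩
  letI : Fintype 𝓀[F] := Fintype.ofFinite _
  have hu := fun κ : Fin (n + 2) → 𝓀[F] => exists_lastColumn_unipotent (F := F) (n := n) (fun i => (sec (κ i) : F))
  choose u huP huval huinv using hu
  set uP : (Fin (n + 1) → 𝓀[F]) → ↥(standardParabolicGL F (lastBlockLabel (n + 2))) := fun κ => ⟨u (Fin.snoc κ 0), huP _⟩ with huP_def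
  have hlast : ∀ k : Fin (n + 1), (Fin.castSucc k : Fin (n + 2)) ≠ Fin.last (n + 1) := fun k =>
    (Fin.castSucc_lt_last k).ne
  -- last row of an element of `P`
  have hProw : ∀ (y : ↥(standardParabolicGL F (lastBlockLabel (n + 2)))) (j : Fin (n + 2)), j ≠ Fin.last (n + 1) →
      ((y : GL (Fin (n + 2)) F) : Matrix (Fin (n + 2)) (Fin (n + 2)) F) (Fin.last (n + 1)) j = 0 := fun y j hj =>
    (mem_standardParabolicGL_lastBlockLabel_iff _).1 y.2 j hj
  -- entries of `u(β)⁻¹ y`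
  have huinv_mul : ∀ (κ : Fin (n + 2) → 𝓀[F]) (y : ↥(standardParabolicGL F (lastBlockLabel (n + 2)))) (i j : Fin (n + 2)),
      (((u κ)⁻¹ * (y : GL (Fin (n + 2)) F) : GL (Fin (n + 2)) F) : Matrix (Fin (n + 2)) (Fin (n + 2)) F) i j =
        ((y : GL (Fin (n + 2)) F) : Matrix (Fin (n + 2)) (Fin (n + 2)) F) i j -
          if i ≠ Fin.last (n + 1) then (sec (κ i) : F) * ((y : GL (Fin (n + 2)) F) : Matrix (Fin (n + 2)) (Fin (n + 2)) F) (Fin.last (n + 1)) j else 0 := by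
    intro κ y i j
    rw [Units.val_mul, Matrix.mul_apply]
    have : ∀ k, (((u κ)⁻¹ : GL (Fin (n + 2)) F) : Matrix (Fin (n + 2)) (Fin (n + 2)) F) i k * ((y : GL (Fin (n + 2)) F) : Matrix (Fin (n + 2)) (Fin (n + 2)) F) k j =
        (1 : Matrix (Fin (n + 2)) (Fin (n + 2)) F) i k * ((y : GL (Fin (n + 2)) F) : Matrix (Fin (n + 2)) (Fin (n + 2)) F) k j -
          (if k = Fin.last (n + 1) ∧ i ≠ Fin.last (n + 1) then (sec (κ i) : F) else 0) * ((y : GL (Fin (n + 2)) F) : Matrix (Fin (n + 2)) (Fin (n + 2)) F) k j := by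
      intro k; rw [huinv, sub_mul]
    rw [Finset.sum_congr rfl fun k _ => this k, Finset.sum_sub_distrib, ← Matrix.mul_apply, Matrix.one_mul,
      Finset.sum_eq_single (Fin.last (n + 1))]
    · by_cases hi : i ≠ Fin.last (n + 1)
      · rw [if_pos ⟨rfl, hi⟩, if_pos hi]
      · rw [if_neg (fun h => hi h.2), if_neg hi, zero_mul]
    · intro k _ hk; rw [if_neg (fun h => hk h.1), zero_mul]
    · intro h; exact absurd (Finset.mem_univ _) h
  -- entries of `d⁻¹ y d`
  have hdconj : ∀ (y : ↥(standardParabolicGL F (lastBlockLabel (n + 2)))) (i j : Fin (n + 2)),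
      (((d⁻¹ * y * d : ↥(standardParabolicGL F (lastBlockLabel (n + 2)))) : GL (Fin (n + 2)) F) : Matrix (Fin (n + 2)) (Fin (n + 2)) F) i j =
        ((if i = Fin.last (n + 1) then ϖ⁻¹ else 1) * ((y : GL (Fin (n + 2)) F) : Matrix (Fin (n + 2)) (Fin (n + 2)) F) i j) *
          if j = Fin.last (n + 1) then ϖ else 1 := by
    intro y i j
    change (((diagGL (Fin (n + 2)) (Function.update 1 (Fin.last (n + 1)) (Units.mk0 ϖ hϖ.ne_zero)))⁻¹ *
      (y : GL (Fin (n + 2)) F) * diagGL (Fin (n + 2)) (Function.update 1 (Fin.last (n + 1)) (Units.mk0 ϖ hϖ.ne_zero)) : GL (Fin (n + 2)) F) :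
        Matrix (Fin (n + 2)) (Fin (n + 2)) F) i j = _
    rw [coe_diagGL_inv_mul_mul_apply]
    simp only [Function.update_apply, Pi.one_apply]
    split_ifs <;> simp [Units.val_inv_eq_inv_val]
  -- membership in `K` of `d⁻¹ y d` and of `u⁻¹ y`, spelled out
  have hv1 : ∀ κ : 𝓀[F], valuation F (sec κ : F) ≤ 1 := fun κ => (Valuation.mem_integer_iff _ _).1 (sec κ).2
  have hϖτ : ∀ x : F, ϖ⁻¹ * x * ϖ = x := fun x => by
    rw [mul_assoc, mul_comm x ϖ, ← mul_assoc, inv_mul_cancel₀ hϖ.ne_zero, one_mul]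
  have hτ : ∀ (y : ↥(standardParabolicGL F (lastBlockLabel (n + 2)))), valuation F (((y : GL (Fin (n + 2)) F) : Matrix (Fin (n + 2)) (Fin (n + 2)) F) (Fin.last (n + 1)) (Fin.last (n + 1)) - 1) ≤ γ →
      valuation F (((y : GL (Fin (n + 2)) F) : Matrix (Fin (n + 2)) (Fin (n + 2)) F) (Fin.last (n + 1)) (Fin.last (n + 1))) ≤ 1 := by
    intro y h
    have := Valuation.map_add_le (valuation F) (h.trans hγ1.le) (le_of_eq (valuation F).map_one)
    rwa [sub_add_cancel] at this
  -- THE SET IDENTITY: `d K d⁻¹ = ⋃_κ u(κ) K`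
  have hset : (fun y : ↥(standardParabolicGL F (lastBlockLabel (n + 2))) => d⁻¹ * y * d) ⁻¹' (K : Set ↥(standardParabolicGL F (lastBlockLabel (n + 2)))) = ⋃ κ, uP κ • (K : Set ↥(standardParabolicGL F (lastBlockLabel (n + 2)))) := by
    ext y
    simp only [Set.mem_preimage, SetLike.mem_coe, Set.mem_iUnion]
    constructor
    · intro hy
      rw [hKmem] at hy
      -- integrality of the last column
      have hint : ∀ i : Fin (n + 2), i ≠ Fin.last (n + 1) →
          valuation F (((y : GL (Fin (n + 2)) F) : Matrix (Fin (n + 2)) (Fin (n + 2)) F) i (Fin.last (n + 1))) ≤ 1 := by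
        intro i hi
        have h := hy i (Fin.last (n + 1))
        rw [hdconj, if_neg hi, if_pos rfl, one_mul, Matrix.one_apply_ne hi, sub_zero, map_mul, ← hγ] at h
        have h' : valuation F (((y : GL (Fin (n + 2)) F) : Matrix (Fin (n + 2)) (Fin (n + 2)) F) i (Fin.last (n + 1))) * γ ≤ 1 * γ := by rwa [one_mul]
        exact le_of_mul_le_mul_right h' (zero_lt_iff.2 hγ0)
      refine ⟨fun k => IsLocalRing.residue _ ⟨_, (Valuation.mem_integer_iff _ _).2 (hint _ (hlast k))⟩, ?_⟩
      rw [mem_leftCoset_iff, SetLike.mem_coe, hKmem]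
      intro i j
      change valuation F ((((u _)⁻¹ * (y : GL (Fin (n + 2)) F) : GL (Fin (n + 2)) F) : Matrix (Fin (n + 2)) (Fin (n + 2)) F) i j - _) ≤ γ
      rw [huinv_mul]
      by_cases hj : j = Fin.last (n + 1)
      · subst hj
        by_cases hi : i = Fin.last (n + 1)
        · subst hi
          rw [if_neg (not_not.2 rfl), sub_zero]
          have h := hy (Fin.last (n + 1)) (Fin.last (n + 1))
          rwa [hdconj, if_pos rfl, if_pos rfl, hϖτ] at h
        · rw [if_pos hi, Matrix.one_apply_ne hi, sub_zero]
          -- `y_{i,last} - s(κ_i) τ = (y_{i,last} - s κ_i) + s κ_i (1 - τ)`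
          obtain ⟨k, rfl⟩ : ∃ k : Fin (n + 1), Fin.castSucc k = i := ⟨i.castPred hi, Fin.castSucc_castPred _ _⟩
          have e1 : ((y : GL (Fin (n + 2)) F) : Matrix (Fin (n + 2)) (Fin (n + 2)) F) (Fin.castSucc k) (Fin.last (n + 1)) -
              (sec (Fin.snoc (α := fun _ => 𝓀[F])
                (fun k => IsLocalRing.residue _ ⟨((y : GL (Fin (n + 2)) F) : Matrix (Fin (n + 2)) (Fin (n + 2)) F) (Fin.castSucc k) (Fin.last (n + 1)),
                  (Valuation.mem_integer_iff _ _).2 (hint _ (hlast k))⟩) 0 (Fin.castSucc k)) : F) *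
                ((y : GL (Fin (n + 2)) F) : Matrix (Fin (n + 2)) (Fin (n + 2)) F) (Fin.last (n + 1)) (Fin.last (n + 1)) =
              (((y : GL (Fin (n + 2)) F) : Matrix (Fin (n + 2)) (Fin (n + 2)) F) (Fin.castSucc k) (Fin.last (n + 1)) -
                (sec (IsLocalRing.residue _ ⟨((y : GL (Fin (n + 2)) F) : Matrix (Fin (n + 2)) (Fin (n + 2)) F) (Fin.castSucc k) (Fin.last (n + 1)),
                  (Valuation.mem_integer_iff _ _).2 (hint _ (hlast k))⟩) : F)) +
              (sec (IsLocalRing.residue _ ⟨((y : GL (Fin (n + 2)) F) : Matrix (Fin (n + 2)) (Fin (n + 2)) F) (Fin.castSucc k) (Fin.last (n + 1)),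
                  (Valuation.mem_integer_iff _ _).2 (hint _ (hlast k))⟩) : F) *
                (1 - ((y : GL (Fin (n + 2)) F) : Matrix (Fin (n + 2)) (Fin (n + 2)) F) (Fin.last (n + 1)) (Fin.last (n + 1))) := by
            rw [Fin.snoc_castSucc]; ring
          rw [e1]
          refine Valuation.map_add_le _ ?_ ?_
          · rw [hγ, ← valuation_lt_one_iff_le_valuation' hϖ]
            exact (DeltaCharBorel.residue_eq_residue_iff
              ⟨_, (Valuation.mem_integer_iff _ _).2 (hint _ (hlast k))⟩ _).1 (hsec _).symm
          · rw [map_mul, ← neg_sub, Valuation.map_neg]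
            have h := hy (Fin.last (n + 1)) (Fin.last (n + 1))
            rw [hdconj, if_pos rfl, if_pos rfl, hϖτ, Matrix.one_apply_eq] at h
            exact mul_le_of_le_one_of_le (hv1 _) h
      · -- columns `j ≠ last`: `u⁻¹ y` and `d⁻¹ y d` agree with `y` there (the last row of `y` vanishes)
        rw [hProw y j hj, mul_zero]
        simp only [ite_self, sub_zero]
        by_cases hi : i = Fin.last (n + 1)
        · subst hi
          rw [hProw y j hj, Matrix.one_apply_ne (Ne.symm hj), sub_zero, map_zero]; exact zero_le
        · have h := hy i j
          rwa [hdconj, if_neg hi, if_neg hj, one_mul, mul_one] at h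
    · rintro ⟨κ, hy⟩
      rw [mem_leftCoset_iff, SetLike.mem_coe, hKmem] at hy
      rw [hKmem]
      have hy' : ∀ i j : Fin (n + 2), valuation F ((((u (Fin.snoc κ 0))⁻¹ * (y : GL (Fin (n + 2)) F) : GL (Fin (n + 2)) F) : Matrix (Fin (n + 2)) (Fin (n + 2)) F) i j -
          (1 : Matrix (Fin (n + 2)) (Fin (n + 2)) F) i j) ≤ γ := hy
      intro i j
      rw [hdconj]
      by_cases hj : j = Fin.last (n + 1)
      · subst hj
        by_cases hi : i = Fin.last (n + 1)
        · subst hi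
          rw [if_pos rfl, if_pos rfl, hϖτ]
          have h := hy' (Fin.last (n + 1)) (Fin.last (n + 1))
          rwa [huinv_mul, if_neg (not_not.2 rfl), sub_zero] at h
        · rw [if_neg hi, if_pos rfl, one_mul, Matrix.one_apply_ne hi, sub_zero, map_mul, ← hγ]
          -- `y_{i,last} = (u⁻¹ y)_{i,last} + s κ_i τ` has valuation `≤ 1`
          have hτ' := hτ y (by
            have h := hy' (Fin.last (n + 1)) (Fin.last (n + 1))
            rwa [huinv_mul, if_neg (not_not.2 rfl), sub_zero, Matrix.one_apply_eq] at h)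
          have h := hy' i (Fin.last (n + 1))
          rw [huinv_mul, if_pos hi, Matrix.one_apply_ne hi, sub_zero] at h
          have e1 : ((y : GL (Fin (n + 2)) F) : Matrix (Fin (n + 2)) (Fin (n + 2)) F) i (Fin.last (n + 1)) =
              (((y : GL (Fin (n + 2)) F) : Matrix (Fin (n + 2)) (Fin (n + 2)) F) i (Fin.last (n + 1)) -
                (sec (Fin.snoc (α := fun _ => 𝓀[F]) κ 0 i) : F) * ((y : GL (Fin (n + 2)) F) : Matrix (Fin (n + 2)) (Fin (n + 2)) F) (Fin.last (n + 1)) (Fin.last (n + 1))) +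
              (sec (Fin.snoc (α := fun _ => 𝓀[F]) κ 0 i) : F) * ((y : GL (Fin (n + 2)) F) : Matrix (Fin (n + 2)) (Fin (n + 2)) F) (Fin.last (n + 1)) (Fin.last (n + 1)) := by
            ring
          have h2 : valuation F (((y : GL (Fin (n + 2)) F) : Matrix (Fin (n + 2)) (Fin (n + 2)) F) i (Fin.last (n + 1))) ≤ 1 := by
            rw [e1]
            refine Valuation.map_add_le _ (h.trans hγ1.le) ?_
            rw [map_mul]
            exact mul_le_one' (hv1 _) hτ'
          exact mul_le_of_le_one_left' h2
      · rw [if_neg hj, mul_one]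
        by_cases hi : i = Fin.last (n + 1)
        · subst hi
          rw [hProw y j hj, mul_zero, Matrix.one_apply_ne (Ne.symm hj), sub_zero, map_zero]; exact zero_le
        · rw [if_neg hi, one_mul]
          have h := hy' i j
          rw [huinv_mul, hProw y j hj, mul_zero] at h
          simpa only [ite_self, sub_zero] using h
  -- the representatives are pairwise inequivalent modulo `K`
  have huPval : ∀ (κ : Fin (n + 1) → 𝓀[F]) (k : Fin (n + 1)),
      (((uP κ : ↥(standardParabolicGL F (lastBlockLabel (n + 2)))) : GL (Fin (n + 2)) F) : Matrix (Fin (n + 2)) (Fin (n + 2)) F) (Fin.castSucc k) (Fin.last (n + 1)) = (sec (κ k) : F) := by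
    intro κ k
    change ((u (Fin.snoc κ 0) : GL (Fin (n + 2)) F) : Matrix (Fin (n + 2)) (Fin (n + 2)) F) _ _ = _
    rw [huval, Matrix.one_apply_ne (hlast k), zero_add, if_pos ⟨rfl, hlast k⟩, Fin.snoc_castSucc]
  have huPlast : ∀ (κ : Fin (n + 1) → 𝓀[F]),
      (((uP κ : ↥(standardParabolicGL F (lastBlockLabel (n + 2)))) : GL (Fin (n + 2)) F) : Matrix (Fin (n + 2)) (Fin (n + 2)) F) (Fin.last (n + 1)) (Fin.last (n + 1)) = 1 := by
    intro κ
    change ((u (Fin.snoc κ 0) : GL (Fin (n + 2)) F) : Matrix (Fin (n + 2)) (Fin (n + 2)) F) _ _ = _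
    rw [huval, Matrix.one_apply_eq, if_neg (fun h => h.2 rfl), add_zero]
  have hinj : ∀ κ κ' : Fin (n + 1) → 𝓀[F], (uP κ)⁻¹ * uP κ' ∈ K → κ = κ' := by
    intro κ κ' h
    rw [hKmem] at h
    funext k
    have hk := h (Fin.castSucc k) (Fin.last (n + 1))
    have e : ((((uP κ)⁻¹ * uP κ' : ↥(standardParabolicGL F (lastBlockLabel (n + 2)))) : GL (Fin (n + 2)) F) : Matrix (Fin (n + 2)) (Fin (n + 2)) F) (Fin.castSucc k) (Fin.last (n + 1)) =
        (sec (κ' k) : F) - sec (κ k) := by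
      change ((((u (Fin.snoc κ 0))⁻¹ * ((uP κ' : ↥(standardParabolicGL F (lastBlockLabel (n + 2)))) : GL (Fin (n + 2)) F) : GL (Fin (n + 2)) F)) : Matrix (Fin (n + 2)) (Fin (n + 2)) F) (Fin.castSucc k) (Fin.last (n + 1)) = _
      rw [huinv_mul, if_pos (hlast k), huPval, huPlast, mul_one, Fin.snoc_castSucc]
    rw [e, Matrix.one_apply_ne (hlast k), sub_zero, hγ, ← valuation_lt_one_iff_le_valuation' hϖ,
      ← DeltaCharBorel.residue_eq_residue_iff, hsec, hsec] at hk
    exact hk.symm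
  -- the measure computation: `Δ(d) μ(K) = μ(d K d⁻¹) = q^{n+1} μ(K)`
  have h1 := DeltaCharBorel.modularCharacter_mul_measure_eq μ hKo d
  rw [hset, DeltaCharBorel.measure_iUnion_smul_subgroup μ K hKo.measurableSet uP hinj] at h1
  have hcard : (Nat.card (Fin (n + 1) → 𝓀[F]) : ℝ≥0∞) =
      (((GaloisRepresentations.IsNonarchimedeanLocalField.residueFieldCard F : ℝ≥0) ^ (n + 1) : ℝ≥0) : ℝ≥0∞) := by
    rw [Nat.card_fun, Nat.card_eq_fintype_card (α := Fin (n + 1)), Fintype.card_fin,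
      GaloisRepresentations.IsNonarchimedeanLocalField.residueFieldCard]
    push_cast
    rfl
  have h0 : μ K ≠ 0 := hKo.measure_ne_zero μ ⟨1, K.one_mem⟩
  have htop : μ K ≠ ⊤ := hKc.measure_lt_top.ne
  rw [hcard, ENNReal.mul_left_inj h0 htop] at h1
  exact_mod_cast h1

/-! ### `Δ_P(d₀(ϖ)) = q_F⁻¹` -/

/-- **The modulus is trivial on the centre**: `Δ_P(t · 1) = 1` (conjugation by a scalar matrix is the
identity). [cite: BernsteinZelevinskyASENS1977, 1.7] -/
theorem modularCharacter_scalar (t : Fˣ) :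
    Measure.modularCharacter (⟨diagGL (Fin (n + 2)) (fun _ => t), diagGL_mem_standardParabolicGL _ _⟩ : ↥(standardParabolicGL F (lastBlockLabel (n + 2)))) = 1 := by
  classical
  haveI : T2Space F := (GaloisRepresentations.IsNonarchimedeanLocalField.isLocalField F).toT2Space
  borelize ↥(standardParabolicGL F (lastBlockLabel (n + 2)))
  set μ : Measure ↥(standardParabolicGL F (lastBlockLabel (n + 2))) := Measure.haar with hμ
  obtain ⟨ϖ, hϖ⟩ := DeltaCharBorel.exists_uniformizer F
  set γ : ValueGroupWithZero F := valuation F ϖ with hγ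
  have hγ0 : γ ≠ 0 := DeltaCharBorel.valuation_uniformizer_ne_zero hϖ
  set K : Subgroup ↥(standardParabolicGL F (lastBlockLabel (n + 2))) :=
    (congruenceGL (n + 2) γ).comap (standardParabolicGL F (lastBlockLabel (n + 2))).subtype with hK
  have hKo : IsOpen (K : Set ↥(standardParabolicGL F (lastBlockLabel (n + 2)))) := (isOpen_congruenceGL hγ0).preimage continuous_subtype_val
  have hKc : IsCompact (K : Set ↥(standardParabolicGL F (lastBlockLabel (n + 2)))) :=
    (isClosed_standardParabolicGL F (lastBlockLabel (n + 2))).isClosedEmbedding_subtypeVal.isCompact_preimage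
      (isCompact_congruenceGL γ)
  refine DeltaCharBorel.modularCharacter_eq_one_of_conj_preimage_eq μ hKo ⟨1, K.one_mem⟩ hKc.measure_lt_top.ne ?_
  -- conjugation by the central element is the identity
  have hz : ∀ y : ↥(standardParabolicGL F (lastBlockLabel (n + 2))), (⟨diagGL (Fin (n + 2)) (fun _ => t), diagGL_mem_standardParabolicGL _ _⟩ : ↥(standardParabolicGL F (lastBlockLabel (n + 2))))⁻¹ * y *
      ⟨diagGL (Fin (n + 2)) (fun _ => t), diagGL_mem_standardParabolicGL _ _⟩ = y := by
    intro y
    have hcomm : y * ⟨diagGL (Fin (n + 2)) (fun _ => t), diagGL_mem_standardParabolicGL _ _⟩ =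
        (⟨diagGL (Fin (n + 2)) (fun _ => t), diagGL_mem_standardParabolicGL _ _⟩ : ↥(standardParabolicGL F (lastBlockLabel (n + 2)))) * y := by
      apply Subtype.ext
      change (y : GL (Fin (n + 2)) F) * diagGL (Fin (n + 2)) (fun _ => t) = diagGL (Fin (n + 2)) (fun _ => t) * y
      apply Units.ext
      rw [Units.val_mul, Units.val_mul, val_diagGL, ← Matrix.scalar_apply]
      exact ((Matrix.scalar_commute (t : F) (fun r' => Commute.all _ r') _).eq).symm
    rw [mul_assoc, hcomm, inv_mul_cancel_left]
  ext y
  simp only [Set.mem_preimage, hz]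

/-- The modulus is invariant under the Weyl group of the Levi: `Δ_P(d_i(t)) = Δ_P(d₀(t))` for the
diagonal elements `d_i(t) = diag(1, …, t, …, 1)` with `t` at a position `i < N - 1` of the first
block (conjugate by the permutation matrix of the transposition `(0 i) ∈ Q_{N-1,1}`).
[cite: BernsteinZelevinskyASENS1977, 1.7] -/
theorem modularCharacter_diag_castSucc (t : Fˣ) (k : Fin (n + 1)) :
    Measure.modularCharacter (⟨diagGL (Fin (n + 2)) (Function.update 1 (Fin.castSucc k) t),
        diagGL_mem_standardParabolicGL _ _⟩ : ↥(standardParabolicGL F (lastBlockLabel (n + 2)))) =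
      Measure.modularCharacter (⟨diagGL (Fin (n + 2)) (Function.update 1 0 t),
        diagGL_mem_standardParabolicGL _ _⟩ : ↥(standardParabolicGL F (lastBlockLabel (n + 2)))) := by
  classical
  haveI : T2Space F := (GaloisRepresentations.IsNonarchimedeanLocalField.isLocalField F).toT2Space
  have hlast : (Fin.castSucc k : Fin (n + 2)) ≠ Fin.last (n + 1) := (Fin.castSucc_lt_last k).ne
  -- the transposition `(0, k)` lies in `Q_{N-1,1}`
  have hw : (permGL (Equiv.swap 0 (Fin.castSucc k)) : GL (Fin (n + 2)) F) ∈ standardParabolicGL F (lastBlockLabel (n + 2)) := by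
    refine permGL_mem_standardParabolicGL _ fun i => le_of_eq ?_
    have hfix : Equiv.swap (0 : Fin (n + 2)) (Fin.castSucc k) (Fin.last (n + 1)) = Fin.last (n + 1) :=
      Equiv.swap_apply_of_ne_of_ne (Fin.last_pos'.ne') hlast.symm
    have key : ∀ j : Fin (n + 2), lastBlockLabel (n + 2) j = decide (j = Fin.last (n + 1)) := by
      intro j
      simp only [lastBlockLabel, Fin.ext_iff, Fin.val_last]
      by_cases h : (j : ℕ) = n + 1
      · rw [decide_eq_true h, decide_eq_true (by omega)]
      · rw [decide_eq_false h, decide_eq_false (by have := j.2; omega)]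
    rw [key, key]
    congr 1
    rw [← hfix, Equiv.apply_eq_iff_eq, hfix]
  have hconj : permGL (Equiv.swap 0 (Fin.castSucc k)) * diagGL (Fin (n + 2)) (Function.update 1 (Fin.castSucc k) t) *
      (permGL (Equiv.swap 0 (Fin.castSucc k)))⁻¹ = (diagGL (Fin (n + 2)) (Function.update 1 0 t) : GL (Fin (n + 2)) F) := by
    rw [permGL_mul_diagGL_mul_inv]
    congr 1
    funext i
    simp only [Function.comp_apply, Function.update_apply, Pi.one_apply, Equiv.swap_apply_eq_iff,
      Equiv.swap_apply_right]
  have := DeltaCharBorel.modularCharacter_conj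
    (⟨permGL (Equiv.swap 0 (Fin.castSucc k)), hw⟩ : ↥(standardParabolicGL F (lastBlockLabel (n + 2))))
    (⟨diagGL (Fin (n + 2)) (Function.update 1 (Fin.castSucc k) t), diagGL_mem_standardParabolicGL _ _⟩ : ↥(standardParabolicGL F (lastBlockLabel (n + 2))))
  rw [← this]
  congr 1
  exact Subtype.ext hconj

/-- **The modulus of `Q_{N-1,1}` at `d₀(ϖ) = diag(ϖ, 1, …, 1)` is `q_F⁻¹`**: the `N - 1` conjugates
`d_i(ϖ)`, `i < N - 1`, have the same modulus, their product with `d(ϖ)` is the central `ϖ · 1`, and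
`Δ_P(d(ϖ)) = q_F^{N-1}` (`modularCharacter_diag_last_uniformizer`); `ℝ≥0` has unique roots.
(Classically `δ_{Q_{N-1,1}}(diag(a, t)) = |det a| · |t|^{1-N}`.) [cite: BernsteinZelevinskyASENS1977, 1.7] -/
theorem modularCharacter_diag_zero_uniformizer {ϖ : F} (hϖ : IsUniformizingElement ϖ) :
    Measure.modularCharacter
        (⟨diagGL (Fin (n + 2)) (Function.update 1 0 (Units.mk0 ϖ hϖ.ne_zero)),
          diagGL_mem_standardParabolicGL _ _⟩ : ↥(standardParabolicGL F (lastBlockLabel (n + 2)))) =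
      (GaloisRepresentations.IsNonarchimedeanLocalField.residueFieldCard F : ℝ≥0)⁻¹ := by
  classical
  haveI : T2Space F := (GaloisRepresentations.IsNonarchimedeanLocalField.isLocalField F).toT2Space
  set t : Fˣ := Units.mk0 ϖ hϖ.ne_zero with ht
  -- `u ↦ Δ_P(diag u)` is a homomorphism out of the commutative group `(Fˣ)^N`
  set ψ : (Fin (n + 2) → Fˣ) →* ℝ≥0 := (Measure.modularCharacter (G := ↥(standardParabolicGL F (lastBlockLabel (n + 2))))).comp
    ((diagGL (Fin (n + 2))).codRestrict (standardParabolicGL F (lastBlockLabel (n + 2)))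
      (diagGL_mem_standardParabolicGL (F := F) (lastBlockLabel (n + 2)))) with hψ
  have hψapply : ∀ u : Fin (n + 2) → Fˣ, ψ u =
      Measure.modularCharacter (⟨diagGL (Fin (n + 2)) u, diagGL_mem_standardParabolicGL _ _⟩ : ↥(standardParabolicGL F (lastBlockLabel (n + 2)))) := fun u => rfl
  -- the product of all `d_i(ϖ)` is the scalar `ϖ · 1`, of modulus `1`
  have h1 : (∏ i : Fin (n + 2), ψ (Function.update 1 i t)) = 1 := by
    rw [← map_prod, show (∏ i : Fin (n + 2), Function.update (1 : Fin (n + 2) → Fˣ) i t) = fun _ => t from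
      Finset.univ_prod_mulSingle (fun _ : Fin (n + 2) => t), hψapply]
    exact modularCharacter_scalar t
  rw [Fin.prod_univ_castSucc] at h1
  have h2 : ∀ k : Fin (n + 1), ψ (Function.update 1 (Fin.castSucc k) t) = ψ (Function.update 1 0 t) :=
    fun k => by rw [hψapply, hψapply]; exact modularCharacter_diag_castSucc t k
  rw [Finset.prod_congr rfl fun k _ => h2 k, Finset.prod_const, Finset.card_univ, Fintype.card_fin] at h1
  have h3 : ψ (Function.update 1 (Fin.last (n + 1)) t) =
      (GaloisRepresentations.IsNonarchimedeanLocalField.residueFieldCard F : ℝ≥0) ^ (n + 1) := by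
    rw [hψapply]; exact modularCharacter_diag_last_uniformizer hϖ
  rw [h3] at h1
  rw [← hψapply]
  have hq : (GaloisRepresentations.IsNonarchimedeanLocalField.residueFieldCard F : ℝ≥0) ≠ 0 :=
    Nat.cast_ne_zero.2 (GaloisRepresentations.IsNonarchimedeanLocalField.residueFieldCard_ne_zero F)
  have h4 : ψ (Function.update 1 0 t) ^ (n + 1) =
      ((GaloisRepresentations.IsNonarchimedeanLocalField.residueFieldCard F : ℝ≥0)⁻¹) ^ (n + 1) := by
    rw [inv_pow]
    exact eq_inv_of_mul_eq_one_left h1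
  exact (pow_left_inj₀ zero_le zero_le (Nat.succ_ne_zero n)).1 h4

end Literature.NumberTheory.Automorphic.Zelevinsky1980

end
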